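import Summits.BirchSwinnertonDyer.BirchSwinnertonDyer.Theorems.PrintCFramBottomClassIndexLawFiveLeOffLocusNoKrizLiDatum7
import Summits.BirchSwinnertonDyer.BirchSwinnertonDyer.Theorems.PrintCFramBottomClassIndexLawFiveLeKrizLiBindersKroneckerOdd
import Summits.BirchSwinnertonDyer.BirchSwinnertonDyer.Theorems.PrintCFramBottomClassIndexLawFiveLeKrizLiBindersKroneckerField
import Summits.BirchSwinnertonDyer.Rank1Residual.X12.O11.RouteUJacobiCertificate
import Summits.BirchSwinnertonDyer.Rank1Residual.X12.O11.RouteUBernoulliD11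
import Literature.NumberTheory.EllipticCurves.KrizLi2019.TeichmullerCharacterExists
import Mathlib.Tactic.NormNum.LegendreSymbol
import HarnessLib

/-!
# Crux `PrintCFram.BottomClassIndexLawFiveLe` (stmt-BirchSwinnertonDyer-20372), line `eisenstein-resource-bdp-line` (registry v10):
# the Kriz–Li Bernoulli block at a TWISTED member — generic odd twisting discriminant + the first `p = 11` instance 3025a / `d_K = −19`
# (cell `bsd-print-cfram`, width seat `bsd-line-cfram-p1-w3` g3; THEOREMS ONLY, `--supports` 20372; BSD is not proved by any of this)

HONEST FRAMING. Nothing here is a statement about BSD; no stub of the skeleton is closed. The ON-LOCUS branch of registry v10 (Stub H +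
prints + Kriz–Li Thm. 1.20) consumes, per member `W` and Heegner field `K''`, the character ∧ `ε_K` ∧ Bernoulli block
`(f ψ ω εK ∣ hψ hω hss h1 h1' h3 hεK h4)`. w3 g2 built it at the five UNTWISTED anchors `A(11), A(19), A(43), A(67), A(163)`
(`AnchorBase.exists_krizLiCharacterBlock_base`, `χ = 1`) and listed the TWISTED members (58 of the 63 on-locus window classes of the
w2 g4 census) as successor item (a). THIS FILE is the twisted template and its first instance:

* §1 **`krizLi_characterBernoulliBlock_twist_odd`** (generic; `p` odd, `E` good away from `p` with trace form `ℓ^k + ℓ^{p−k}`, `W ∼ W₁ ≅ E^{(e)}`,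
  `e ≡ 1 (mod 4)` squarefree, `p ∤ e`, `χ` the Jacobi character mod `|e|` with `χ(−1)(−1)^k = −1`, Heegner prime `q ∤ 2pe`, `ε_K = (·/q)`):
  from the UNIT certificates `‖B_{1,θ₁}‖ = 1`, `θ₁(j) = (j/|e|)·ω(j)^{p−1−k}` mod `p|e|` (class factor `ψ⁻¹`) and `‖B_{1,θ₂}‖ = 1`,
  `θ₂(j) = (j/|e|q)·ω(j)^{k−1}` mod `p|e|q` (`K''`-factor `ψε_Kω⁻¹`), the block for `ψ = χ·ω^k`: PRIMITIVE, ODD, `hss`, (1), (3) (w3 g2's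
  `KrizLiBinders.krizLiBinders_of_coprime_twist_odd`) and Kriz–Li's (4). The identification `ψ₀ω⁻¹ = θ₂↑` is a unit-by-unit value
  computation ((·/|e|)(·/q) = (·/|e|q), `ω^k·ω⁻¹ = ω^{k−1}` at `p`-units).
* §2 the instance 3025a (`E = A(11) = 121b`, `e = 5`, `k = 3`, `p = 11`, `q = 19`; w2 g4 census «3025a1 d = 5 ψ = χ₅ω³ | −19: Y»): kernel
  certificates `certSum_55` (`S₁ = 1430 = 11·130`, class factor `‖B_{1,χ₅ω⁷}‖₁₁ = 1`) and `certSum_1045` (`S₂ = 8360 = 11·760`, `K''`-factor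
  `‖B_{1,χ₉₅ω²}‖₁₁ = 1`; Jacobi mod `95 = 5·19` by `jacobiSym_mul_right'` + Euler's criterion; tables = w3 g2's `teichmullerPowTable_11_7/_11_2`),
  and **`exists_krizLiCharacterBlock_3025a`**: for every `W` `ℚ`-isogenous to a curve `ℚ`-isomorphic to `cm11.quadraticTwist 5` and every quadratic
  `K''` of discriminant `−19`, `∃ f ψ ω εK` with `hψ hω hss h1 h1' h3 hεK h4 ∧ ψ.Odd` — 3025a lies ON the Kriz–Li locus BY NAME. (The `𝒞₇`
  twisted members at `p = 7`, e.g. 441d1/ℚ(√−47), are bsd-cm's Route U — `RouteUSeven441d1`, `RouteUMember*` — and are NOT repeated.)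

beyond-print theorem: NO. References: [KrizLi2019] Thm. 1.20 (pp. 7–8), Rem. 1.21, §1.5, §2, §7.1; [Washington1997] §5.1, Thm. 4.2;
[Cox2013] §1.C Lemma 1.14; Cremona tables (3025a = `121b` twisted by `5`).
-/

set_option autoImplicit false
set_option linter.dupNamespace false

noncomputable section

open scoped Classical

namespace Summit.BirchSwinnertonDyer.BirchSwinnertonDyer.Theorems.PrintCFram.KrizLiBindersTwisted

open scoped NumberTheorySymbols
open WeierstrassCurve IsDedekindDomain NumberField DirichletCharacter Literature.NumberTheory.LFunctions
  Literature.NumberTheory.EllipticCurves Literature.NumberTheory.EllipticCurves.ModularForms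
  Literature.NumberTheory.EllipticCurves.Rank1Residual Literature.NumberTheory.EllipticCurves.KrizLi2019
  Summit.BirchSwinnertonDyer.Rank1Residual Summit.BirchSwinnertonDyer.Rank1Residual.X12.O11
  Summit.BirchSwinnertonDyer.BirchSwinnertonDyer.Theorems.PrintCFram.OffLocus

variable {p : ℕ} [hp : Fact p.Prime]

/-! ## §1 The Bernoulli block at a TWISTED member (odd twisting discriminant) from two unit certificates -/

set_option maxHeartbeats 800000 in
/-- **THE CHARACTER ∧ BERNOULLI BLOCK AT A TWISTED MEMBER, FROM TWO CERTIFICATES.** `p` odd; `E/ℚ` good away from `p` with trace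
form `a_ℓ(E) ≡ ℓ^k + ℓ^{p−k}` (`2 ≤ k ≤ p−2`); `W ∼ W₁ ≅ E^{(e)}` with `e ≡ 1 (mod 4)` squarefree, `p ∤ e`; `χ` the `ℚ_p`-valued Jacobi
character mod `|e|` with `χ(−1)·(−1)^k = −1` (so `ψ = χ·ω^k` is odd); `ω` Teichmüller; `q ∤ 2pe` an odd prime and `εK` with values
`(·/q)`. From the UNIT certificates `‖B_{1,θ₁}‖ = 1` for `θ₁(j) = (j/|e|)·ω(j)^{p−1−k}` mod `p|e|` (class factor `ψ⁻¹`) and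
`‖B_{1,θ₂}‖ = 1` for `θ₂(j) = (j/|e|q)·ω(j)^{k−1}` mod `p|e|q` (`K''`-factor `ψε_Kω⁻¹`): `ψ` is PRIMITIVE, ODD, has `hss`, (1), (3)
for `W`, and Kriz–Li's (4) `¬ ‖B_{1,ψ₀⁻¹ε_K}·B_{1,ψ₀ω⁻¹}‖ ≤ p⁻¹` holds. (w3 g2's `AnchorBase.krizLi_characterBernoulliBlock_base` is the
case `e = 1`.) [cite: KrizLi2019, Thm. 1.20 (pp. 7–8), Rem. 1.21, §1.5, §2, §7.1] [cite: Washington1997, §5.1, Thm. 4.2] -/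
theorem krizLi_characterBernoulliBlock_twist_odd (hp2 : p ≠ 2) (E : WeierstrassCurve ℚ) [E.IsElliptic] {k : ℕ}
    (hk2 : 2 ≤ k) (hkp : k ≤ p - 2)
    (hgood : ∀ (r : ℕ) [Fact r.Prime], r ≠ p → E.HasGoodReductionAtPrime r)
    (hbase : ∀ (ℓ : ℕ) [Fact ℓ.Prime], ℓ ≠ p → (E.LFunction ℓ : ZMod p) = (ℓ : ZMod p) ^ k + (ℓ : ZMod p) ^ (p - k))
    (W W₁ : WeierstrassCurve ℚ) [W.IsElliptic] [W₁.IsElliptic] (hiso : IsIsogenous W W₁)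
    {e : ℤ} (he4 : e % 4 = 1) (hsq : Squarefree e) (hpe : ¬ (p : ℤ) ∣ e)
    (hW₁ : ∃ C : VariableChange ℚ, C • W₁ = E.quadraticTwist (e : ℚ)) [NeZero e.natAbs]
    (χ : DirichletCharacter ℚ_[p] e.natAbs) (hχ : ∀ a : ℕ, χ (a : ZMod e.natAbs) = (J((a : ℤ) | e.natAbs) : ℚ_[p]))
    (hpar : χ (-1) * (-1) ^ k = -1)
    (ω : DirichletCharacter ℚ_[p] p) (hω : IsTeichmullerCharacter ω)
    {q : ℕ} [hq : Fact q.Prime] (hqp : q ≠ p) (hq2 : q ≠ 2) (hqe : ¬ (q : ℤ) ∣ e) {d : ℕ} (hd : d = q) [NeZero d]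
    (εK : DirichletCharacter ℚ_[p] d) (hεK : ∀ a : ℕ, εK (a : ZMod d) = (J((a : ℤ) | q) : ℚ_[p]))
    (hcert₁ : ∀ θ₁ : DirichletCharacter ℚ_[p] (p * e.natAbs),
      (∀ j : ZMod (p * e.natAbs), θ₁ j = (J((j.val : ℤ) | e.natAbs) : ℚ_[p]) * ω (j.val : ZMod p) ^ (p - 1 - k)) →
      ‖generalizedBernoulli 1 θ₁‖ = 1)
    (hcert₂ : ∀ θ₂ : DirichletCharacter ℚ_[p] (p * (e.natAbs * q)),
      (∀ j : ZMod (p * (e.natAbs * q)), θ₂ j = (J((j.val : ℤ) | e.natAbs * q) : ℚ_[p]) * ω (j.val : ZMod p) ^ (k - 1)) →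
      ‖generalizedBernoulli 1 θ₂‖ = 1) :
    ∃ (f : ℕ) (_ : NeZero f) (ψ : DirichletCharacter ℚ_[p] f),
      ψ.IsPrimitive ∧ ψ.Odd ∧
      (∀ ℓ : ℕ, ℓ.Prime → ¬ (ℓ ∣ p * W.conductorNorm ℤ) →
        ‖((W.LFunction ℓ : ℤ) : ℚ_[p]) - (ψ (ℓ : ZMod f) + ψ⁻¹ (ℓ : ZMod f) * ω (ℓ : ZMod p))‖ < 1) ∧
      (ψ (p : ZMod f) ≠ 1 ∧ primVal (invMulOmega ψ ω) p ≠ 1) ∧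
      (∀ ℓ : ℕ, (hℓ : ℓ.Prime) → ℓ ≠ p →
        (haveI := Fact.mk hℓ; ¬ W.HasGoodReductionAtPrime ℓ ∧ ¬ W.HasMultiplicativeReductionAtPrime ℓ) →
        ψ (ℓ : ZMod f) ≠ 1 ∧ primVal (invMulOmega ψ ω) ℓ ≠ 1) ∧
      ¬ (‖bernoulliOnePrim (bernoulliCharOne ψ εK) * bernoulliOnePrim (bernoulliCharTwo ψ εK ω)‖ ≤ (p : ℝ)⁻¹) := by
  have hd' := hd.symm
  subst hd'
  have hpp : p.Prime := hp.out
  have hm0 : e.natAbs ≠ 0 := NeZero.ne e.natAbs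
  have hmodd : Odd e.natAbs := by rw [Int.natAbs_odd, Int.odd_iff]; omega
  have hmsq : Squarefree e.natAbs := Int.squarefree_natAbs.mpr hsq
  have hpm : ¬ p ∣ e.natAbs := fun h => hpe (Int.natCast_dvd.mpr h)
  have hmp : (e.natAbs).Coprime p := ((Nat.Prime.coprime_iff_not_dvd hpp).mpr hpm).symm
  have hqm : ¬ q ∣ e.natAbs := fun h => hqe (Int.natCast_dvd.mpr h)
  have hmq : (e.natAbs).Coprime q := ((Nat.Prime.coprime_iff_not_dvd hq.out).mpr hqm).symm
  have hqodd : Odd q := hq.out.odd_of_ne_two hq2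
  haveI : NeZero (p * e.natAbs) := ⟨Nat.mul_ne_zero hpp.ne_zero hm0⟩
  haveI : NeZero (e.natAbs * q) := ⟨Nat.mul_ne_zero hm0 hq.out.ne_zero⟩
  haveI : NeZero (p * (e.natAbs * q)) := ⟨Nat.mul_ne_zero hpp.ne_zero (NeZero.ne _)⟩
  -- the engine (w3 g2, part M)
  obtain ⟨hprim, hss, h1, h3⟩ := KrizLiBinders.krizLiBinders_of_coprime_twist_odd (p := p) hp2 E hk2 hkp hgood hbase
    W W₁ hiso he4 hsq hpe hW₁ χ hχ ω hω
  set ψ : DirichletCharacter ℚ_[p] (p * e.natAbs) :=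
    changeLevel (dvd_mul_left e.natAbs p) χ * changeLevel (dvd_mul_right p e.natAbs) (ω ^ k) with hψdef
  have hodd : ψ.Odd := by
    rw [hψdef]; exact KrizLiBinders.psi_odd_of ω χ k hp2 hω (by omega) hpar
  have hnev : ¬ ψ.Even := EisensteinPair.not_even_of_odd' ψ hodd
  refine ⟨p * e.natAbs, inferInstance, ψ, hprim, hodd, hss, h1, h3, ?_⟩
  -- χ is primitive quadratic
  have hχprim : χ.IsPrimitive := KrizLiBinders.isPrimitive_of_forall_eq_jacobiSym hχ hmodd hmsq
  have hχq : χ⁻¹ = χ := MulChar.IsQuadratic.inv (KrizLiBinders.isQuadratic_of_forall_eq_jacobiSym hχ)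
  -- θ₁ = ψ⁻¹ = χ↑·(ω^{p−1−k})↑
  set θ₁ : DirichletCharacter ℚ_[p] (p * e.natAbs) :=
    changeLevel (dvd_mul_left e.natAbs p) χ * changeLevel (dvd_mul_right p e.natAbs) (ω ^ (p - 1 - k)) with hθ₁def
  have hψinv : ψ⁻¹ = θ₁ := by
    rw [hψdef, hθ₁def, mul_inv, ← map_inv, ← map_inv, hχq, KrizLiBinders.char_pow_inv_eq ω (by omega)]
  have hθ₁prim : θ₁.IsPrimitive :=
    KrizLiBinders.psi_isPrimitive ω χ (p - 1 - k) hmp hχprim (KrizLiBinders.teichmuller_pow_ne_one hω (by omega) (by omega))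
  have hθ₁val : ∀ j : ZMod (p * e.natAbs), θ₁ j = (J((j.val : ℤ) | e.natAbs) : ℚ_[p]) * ω (j.val : ZMod p) ^ (p - 1 - k) := by
    intro j
    rw [hθ₁def, changeLevel_mul_apply_eq (p := p) χ (ω ^ (p - 1 - k)) j, hχ j.val, MulChar.pow_apply' _ (by omega)]
  have hu₁ : ‖generalizedBernoulli 1 θ₁‖ = 1 := hcert₁ θ₁ hθ₁val
  have h₁ : p * e.natAbs ∣ p * e.natAbs * q := dvd_mul_right _ q
  have hχ₁ : bernoulliCharOne ψ εK = changeLevel h₁ θ₁ := by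
    rw [RegularLocusBernoulliPair.bernoulliCharOne_of_not_even ψ εK hnev, hψinv]
  -- θ₂ = χ₂↑·(ω^{k−1})↑ with χ₂ the Jacobi character mod e.natAbs·q
  obtain ⟨χ₂, hχ₂⟩ := KrizLiBinders.exists_jacobiCharPadic (p := p) (e.natAbs * q)
  set θ₂ : DirichletCharacter ℚ_[p] (p * (e.natAbs * q)) :=
    changeLevel (dvd_mul_left (e.natAbs * q) p) χ₂ * changeLevel (dvd_mul_right p (e.natAbs * q)) (ω ^ (k - 1)) with hθ₂def
  have hθ₂prim : θ₂.IsPrimitive :=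
    KrizLiBinders.psi_isPrimitive ω χ₂ (k - 1) (Nat.Coprime.mul_left hmp ((Nat.coprime_primes hq.out hpp).mpr hqp))
      (KrizLiBinders.isPrimitive_of_forall_eq_jacobiSym hχ₂ (hmodd.mul hqodd)
        (Nat.squarefree_mul_iff.mpr ⟨hmq, hmsq, (Nat.Prime.prime hq.out).squarefree⟩))
      (KrizLiBinders.teichmuller_pow_ne_one hω (by omega) (by omega))
  have hθ₂val : ∀ j : ZMod (p * (e.natAbs * q)), θ₂ j = (J((j.val : ℤ) | e.natAbs * q) : ℚ_[p]) * ω (j.val : ZMod p) ^ (k - 1) := by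
    intro j
    rw [hθ₂def, changeLevel_mul_apply_eq (p := p) χ₂ (ω ^ (k - 1)) j, hχ₂ j.val, MulChar.pow_apply' _ (by omega)]
  have hu₂ : ‖generalizedBernoulli 1 θ₂‖ = 1 := hcert₂ θ₂ hθ₂val
  -- identification of `ψ₀ω⁻¹` with the lift of `θ₂`
  have h₂ : p * (e.natAbs * q) ∣ p * e.natAbs * q * p := ⟨p, by ring⟩
  have hχ₂eq : bernoulliCharTwo ψ εK ω = changeLevel h₂ θ₂ := by
    haveI : NeZero (p * e.natAbs * q * p) := ⟨Nat.mul_ne_zero (Nat.mul_ne_zero (NeZero.ne _) hq.out.ne_zero) hpp.ne_zero⟩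
    rw [RegularLocusBernoulliPair.bernoulliCharTwo_of_not_even ψ εK ω hnev]
    refine MulChar.ext fun u => ?_
    -- evaluate both sides at the integer `a = u.val`
    have hcop : ((u : ZMod (p * e.natAbs * q * p)).val).Coprime (p * e.natAbs * q * p) := ZMod.val_coe_unit_coprime u
    have ea : ((u : ZMod (p * e.natAbs * q * p)) : ZMod (p * e.natAbs * q * p)) =
        ((((u : ZMod (p * e.natAbs * q * p)).val : ℕ) : ℤ) : ZMod (p * e.natAbs * q * p)) := by
      rw [Int.cast_natCast, ZMod.natCast_zmod_val]
    set a : ℕ := (u : ZMod (p * e.natAbs * q * p)).val with ha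
    have cL : IsCoprime (a : ℤ) ((p * e.natAbs * q * p : ℕ) : ℤ) := Nat.isCoprime_iff_coprime.mpr hcop
    have cpmq : IsCoprime (a : ℤ) ((p * e.natAbs * q : ℕ) : ℤ) :=
      Nat.isCoprime_iff_coprime.mpr (hcop.coprime_dvd_right (Dvd.intro p rfl))
    have cpm : IsCoprime (a : ℤ) ((p * e.natAbs : ℕ) : ℤ) :=
      Nat.isCoprime_iff_coprime.mpr (hcop.coprime_dvd_right (Dvd.intro (q * p) (by ring)))
    have cpmq' : IsCoprime (a : ℤ) ((p * (e.natAbs * q) : ℕ) : ℤ) :=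
      Nat.isCoprime_iff_coprime.mpr (hcop.coprime_dvd_right ⟨p, by ring⟩)
    have cap : a.Coprime p := hcop.coprime_dvd_right (Dvd.intro (e.natAbs * q * p) (by ring))
    have hpa : ¬ ((p : ℤ) ∣ (a : ℤ)) := by
      rw [Int.natCast_dvd_natCast]; exact fun h => hpp.one_lt.ne' (Nat.Coprime.eq_one_of_dvd cap.symm h) |>.elim
    rw [ea, MulChar.mul_apply, changeLevel_eq_cast_of_dvd' _ _ cL, changeLevel_eq_cast_of_dvd' _ _ cL, MulChar.mul_apply,
      changeLevel_eq_cast_of_dvd' _ _ cpmq, changeLevel_eq_cast_of_dvd' _ _ cpmq, hψdef, MulChar.mul_apply,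
      changeLevel_eq_cast_of_dvd' _ _ cpm, changeLevel_eq_cast_of_dvd' _ _ cpm,
      changeLevel_eq_cast_of_dvd' _ _ cL, hθ₂def, MulChar.mul_apply,
      changeLevel_eq_cast_of_dvd' _ _ cpmq', changeLevel_eq_cast_of_dvd' _ _ cpmq']
    simp only [Int.cast_natCast]
    rw [hχ a, hεK a, hχ₂ a, MulChar.pow_apply' _ (by omega : k ≠ 0), MulChar.pow_apply' _ (by omega : k - 1 ≠ 0),
      MulChar.inv_apply_eq_inv', RouteU.jacobiSym_mul_right' (a : ℤ) hm0 hq.out.ne_zero]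
    have hω0 : ω (a : ZMod p) ≠ 0 := by
      have h1 := norm_apply_eq_one ω (a : ℤ) hpa
      intro h0; rw [Int.cast_natCast] at h1; rw [h0, norm_zero] at h1; exact zero_ne_one h1
    have hk1 : k = (k - 1) + 1 := by omega
    push_cast
    rw [hk1, pow_succ, Nat.add_sub_cancel]
    field_simp
  exact RouteU.bernoulli_hypothesis_of_certs θ₁ hθ₁prim h₁ θ₂ hθ₂prim h₂ _ hχ₁ _ hχ₂eq hu₁ hu₂


/-! ## §2 First twisted instance at `p = 11`: class 3025a (`A(11)^{(5)}`) over `K''` with `d_K = −19` -/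

/-- `ord₁₁(11·5) = 1`. [folklore] -/
theorem padicValNat_11_mul_5 : padicValNat 11 (11 * 5) = 1 := by
  haveI : Fact (Nat.Prime 11) := ⟨by norm_num⟩
  rw [padicValNat.mul (by norm_num) (by norm_num), padicValNat_self, padicValNat.eq_zero_of_not_dvd (by norm_num)]

/-- `ord₁₁(11·95) = 1`. [folklore] -/
theorem padicValNat_11_mul_95 : padicValNat 11 (11 * (5 * 19)) = 1 := by
  haveI : Fact (Nat.Prime 11) := ⟨by norm_num⟩
  rw [padicValNat.mul (by norm_num) (by norm_num), padicValNat_self, padicValNat.eq_zero_of_not_dvd (by norm_num)]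

/-- **Certificate 1 (class factor of 3025a): `S₁ = Σ_{j mod 55} (j/5)·t₇(j mod 11)·j = 1430 = 11·130`, `11² ∤ S₁`** (table `t₇ ≡ j^{77}`
= w3 g2's `teichmullerPowTable_11_7`). [folklore] -/
theorem certSum_55 :
    ((11 : ℕ) : ℤ) ∣ ∑ j : ZMod (11 * 5), (legendreSym 5 (j.val : ℤ) *
        ((([0, 1, 40, 9, 27, 3, 118, 94, 112, 81, 120] : List ℕ).getD (j.val % 11) 0 : ℕ) : ℤ)) * (j.val : ℤ) ^ (0 + 1) ∧
    ¬ ((11 : ℕ) : ℤ) ^ 2 ∣ ∑ j : ZMod (11 * 5), (legendreSym 5 (j.val : ℤ) *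
        ((([0, 1, 40, 9, 27, 3, 118, 94, 112, 81, 120] : List ℕ).getD (j.val % 11) 0 : ℕ) : ℤ)) * (j.val : ℤ) ^ (0 + 1) := by
  constructor
  · simp_rw [RouteU.legendreSym_eq_ite 5 (by norm_num)]
    decide +kernel
  · simp_rw [RouteU.legendreSym_eq_ite 5 (by norm_num)]
    decide +kernel

/-- **Certificate 2 (`K''`-factor of 3025a over `d_K = −19`): `S₂ = Σ_{j mod 1045} (j/95)·t₂(j mod 11)·j = 8360 = 11·760`, `11² ∤ S₂`**
(table `t₂ ≡ j^{22}` = w3 g2's `teichmullerPowTable_11_2`; Jacobi mod `95 = 5·19` split by `RouteU.jacobiSym_mul_right'`, Euler's criterion). [folklore] -/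
theorem certSum_1045 :
    ((11 : ℕ) : ℤ) ∣ ∑ j : ZMod (11 * (5 * 19)), (J((j.val : ℤ) | 5 * 19) *
        ((([0, 1, 81, 9, 27, 3, 3, 27, 9, 81, 1] : List ℕ).getD (j.val % 11) 0 : ℕ) : ℤ)) * (j.val : ℤ) ^ (0 + 1) ∧
    ¬ ((11 : ℕ) : ℤ) ^ 2 ∣ ∑ j : ZMod (11 * (5 * 19)), (J((j.val : ℤ) | 5 * 19) *
        ((([0, 1, 81, 9, 27, 3, 3, 27, 9, 81, 1] : List ℕ).getD (j.val % 11) 0 : ℕ) : ℤ)) * (j.val : ℤ) ^ (0 + 1) := by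
  constructor
  · simp_rw [RouteU.jacobiSym_mul_right' _ (by norm_num : (5 : ℕ) ≠ 0) (by norm_num : (19 : ℕ) ≠ 0),
      RouteU.jacobiSym_prime_eq_ite 5 (by norm_num) (by norm_num), RouteU.jacobiSym_prime_eq_ite 19 (by norm_num) (by norm_num)]
    decide +kernel
  · simp_rw [RouteU.jacobiSym_mul_right' _ (by norm_num : (5 : ℕ) ≠ 0) (by norm_num : (19 : ℕ) ≠ 0),
      RouteU.jacobiSym_prime_eq_ite 5 (by norm_num) (by norm_num), RouteU.jacobiSym_prime_eq_ite 19 (by norm_num) (by norm_num)]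
    decide +kernel

set_option maxRecDepth 40000 in
/-- **`‖B_{1,χ₅·ω⁷}‖₁₁ = 1` — the class factor of 3025a is a UNIT** (`ψ⁻¹ = χ₅ω⁷` for `ψ = χ₅ω³`; census `v₁₁ = 0`). For every Teichmüller
`ω` mod `11` and every `θ₁` mod `55` with values `(j/5)·ω(j)^7`. [cite: KrizLi2019, Thm. 1.20 (p. 8)] [cite: Washington1997, Thm. 4.2] -/
theorem norm_generalizedBernoulli_theta1_3025a [Fact (Nat.Prime 11)] (ω : DirichletCharacter ℚ_[11] 11)
    (hω : IsTeichmullerCharacter ω) (θ₁ : DirichletCharacter ℚ_[11] (11 * 5))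
    (hθ₁ : ∀ j : ZMod (11 * 5), θ₁ j = (J((j.val : ℤ) | 5) : ℚ_[11]) * ω (j.val : ZMod 11) ^ 7) :
    ‖generalizedBernoulli 1 θ₁‖ = 1 := by
  haveI : Fact (Nat.Prime 5) := ⟨by norm_num⟩
  have hθ₁' : ∀ j : ZMod (11 * 5), θ₁ j = (legendreSym 5 (j.val : ℤ) : ℚ_[11]) * ω (j.val : ZMod 11) ^ 7 := by
    intro j; rw [hθ₁ j, jacobiSym.legendreSym.to_jacobiSym]
  have hne : θ₁ ≠ 1 := by
    intro h
    have h2 := hθ₁' ((2 : ℕ) : ZMod (11 * 5))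
    have hv : (((2 : ℕ) : ZMod (11 * 5))).val = 2 := by rw [ZMod.val_natCast]
    have hu : IsUnit (((2 : ℕ) : ZMod (11 * 5))) := (ZMod.isUnit_iff_coprime 2 (11 * 5)).mpr (by norm_num)
    rw [h, MulChar.one_apply hu, hv] at h2
    have hl : (legendreSym 5 ((2 : ℕ) : ℤ) : ℚ_[11]) = -1 := by
      have h5 : legendreSym 5 ((2 : ℕ) : ℤ) = -1 := by
        rw [jacobiSym.legendreSym.to_jacobiSym]; norm_num
      rw [h5]; norm_num
    rw [hl] at h2
    have ht := AnchorReduction.norm_teichmuller_pow_sub_table_le ω hω (k := 7) (by norm_num)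
      (fun j => ([0, 1, 40, 9, 27, 3, 118, 94, 112, 81, 120] : List ℕ).getD j 0) rfl KrizLiBinders.teichmullerPowTable_11_7
      ((2 : ℕ) : ZMod 11)
    have hv2 : (((2 : ℕ) : ZMod 11)).val = 2 := by rw [ZMod.val_natCast]
    rw [hv2] at ht
    simp only [List.getD_cons_succ, List.getD_cons_zero] at ht
    have hw : ω ((2 : ℕ) : ZMod 11) ^ 7 = -1 := by linear_combination h2
    rw [hw] at ht
    have hn : ‖(-1 : ℚ_[11]) - ((40 : ℕ) : ℚ_[11])‖ = 1 := by
      rw [show (-1 : ℚ_[11]) - ((40 : ℕ) : ℚ_[11]) = ((-41 : ℤ) : ℚ_[11]) by push_cast; ring]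
      exact Padic.norm_intCast_eq_one_iff.mpr (by norm_num)
    rw [hn] at ht
    norm_num at ht
  exact AnchorReduction.norm_generalizedBernoulli_legendre_teichmullerPow_of_cert ω hω (k := 7) (by norm_num) padicValNat_11_mul_5
    θ₁ hne hθ₁' (fun j => ([0, 1, 40, 9, 27, 3, 118, 94, 112, 81, 120] : List ℕ).getD j 0) rfl KrizLiBinders.teichmullerPowTable_11_7
    certSum_55.1 certSum_55.2

set_option maxRecDepth 40000 in
/-- **`‖B_{1,χ₉₅·ω²}‖₁₁ = 1` — the `K''`-factor of 3025a over `d_K = −19` is a UNIT** (`ψε_Kω⁻¹ = χ₅χ₋₁₉ω² = χ₉₅ω²`; census «3025a1 | −19: Y»).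
For every Teichmüller `ω` mod `11` and every `θ₂` mod `1045` with values `(j/95)·ω(j)²`. [cite: KrizLi2019, Thm. 1.20 (p. 8)] [cite: Washington1997, Thm. 4.2] -/
theorem norm_generalizedBernoulli_theta2_3025a_19 [Fact (Nat.Prime 11)] (ω : DirichletCharacter ℚ_[11] 11)
    (hω : IsTeichmullerCharacter ω) (θ₂ : DirichletCharacter ℚ_[11] (11 * (5 * 19)))
    (hθ₂ : ∀ j : ZMod (11 * (5 * 19)), θ₂ j = (J((j.val : ℤ) | 5 * 19) : ℚ_[11]) * ω (j.val : ZMod 11) ^ 2) :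
    ‖generalizedBernoulli 1 θ₂‖ = 1 := by
  haveI : NeZero (11 * (5 * 19)) := ⟨by norm_num⟩
  have hne : θ₂ ≠ 1 := by
    intro h
    have h23 := hθ₂ ((23 : ℕ) : ZMod (11 * (5 * 19)))
    have hv : (((23 : ℕ) : ZMod (11 * (5 * 19)))).val = 23 := by rw [ZMod.val_natCast]
    have hu : IsUnit (((23 : ℕ) : ZMod (11 * (5 * 19)))) := (ZMod.isUnit_iff_coprime 23 (11 * (5 * 19))).mpr (by norm_num)
    have h231 : ((23 : ℕ) : ZMod 11) = 1 := ((ZMod.natCast_eq_natCast_iff' 23 1 11).mpr (by norm_num)).trans Nat.cast_one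
    rw [h, MulChar.one_apply hu, hv, h231, map_one, one_pow, mul_one] at h23
    have hj : (J(((23 : ℕ) : ℤ) | 5 * 19) : ℚ_[11]) = -1 := by norm_num
    rw [hj] at h23
    norm_num at h23
  refine RouteU.norm_generalizedBernoulli_one_eq_one_of_cert θ₂ hne padicValNat_11_mul_95
    (fun j => J((j.val : ℤ) | 5 * 19) * ((([0, 1, 81, 9, 27, 3, 3, 27, 9, 81, 1] : List ℕ).getD (j.val % 11) 0 : ℕ) : ℤ)) 0
    (fun j => ?_) certSum_1045.1 certSum_1045.2
  rw [pow_zero, mul_one, hθ₂ j]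
  have hv : (j.val : ZMod 11).val = j.val % 11 := ZMod.val_natCast _ _
  have htab := AnchorReduction.norm_teichmuller_pow_sub_table_le ω hω (k := 2) (by norm_num)
    (fun j => ([0, 1, 81, 9, 27, 3, 3, 27, 9, 81, 1] : List ℕ).getD j 0) rfl KrizLiBinders.teichmullerPowTable_11_2 (j.val : ZMod 11)
  rw [hv] at htab
  have hL : ‖(J((j.val : ℤ) | 5 * 19) : ℚ_[11])‖ ≤ 1 := Padic.norm_int_le_one _
  have hsplit : (J((j.val : ℤ) | 5 * 19) : ℚ_[11]) * ω (j.val : ZMod 11) ^ 2 -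
      ((J((j.val : ℤ) | 5 * 19) * ((([0, 1, 81, 9, 27, 3, 3, 27, 9, 81, 1] : List ℕ).getD (j.val % 11) 0 : ℕ) : ℤ) : ℤ) : ℚ_[11]) =
      (J((j.val : ℤ) | 5 * 19) : ℚ_[11]) *
        (ω (j.val : ZMod 11) ^ 2 - ((([0, 1, 81, 9, 27, 3, 3, 27, 9, 81, 1] : List ℕ).getD (j.val % 11) 0 : ℕ) : ℚ_[11])) := by
    push_cast; ring
  rw [hsplit, norm_mul]
  calc ‖(J((j.val : ℤ) | 5 * 19) : ℚ_[11])‖ * _ ≤ 1 * (11 : ℝ) ^ (-2 : ℤ) := mul_le_mul hL htab (norm_nonneg _) zero_le_one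
    _ = ((11 : ℕ) : ℝ) ^ (-2 : ℤ) := by rw [one_mul]; norm_num

/-- **THE KRIZ–LI CHARACTER ∧ `ε_K` ∧ BERNOULLI BLOCK AT A TWISTED MEMBER OF A `p ≥ 11` CLASS: 3025a (`A(11)^{(5)}`, `p = 11`) over every
quadratic field `K''` of discriminant `−19`** (census first passing `d_K`; `ψ = χ₅·ω³`): for every `W` `ℚ`-isogenous to a curve `ℚ`-isomorphic to
`cm11.quadraticTwist 5`, `∃ f ψ ω εK`, `ψ.IsPrimitive ∧ IsTeichmullerCharacter ω ∧ hss ∧ (1) ∧ (3) ∧ IsKroneckerCharacterOf K'' εK ∧ (4) ∧ ψ.Odd`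
— the hypotheses `f ψ ω hψ hω hss h1 h1' h3 εK hεK h4` of the v10 composition's Kriz–Li branch. So 3025a lies ON the Kriz–Li locus BY NAME
(modulo prints, Thm. 1.20, Stub H, Heegner data and `L(W^{(−19)},1) ≠ 0`). The `𝒞₇` twisted members at `p = 7` are bsd-cm's Route U
(`RouteU.bsdp_seven_of_twist_cm7_prime`, `RouteUSeven441d1`, `RouteUMember*`) and are not repeated here.
[cite: KrizLi2019, Thm. 1.20 (pp. 7–8), Rem. 1.21, §2 (p. 12)] [cite: Cox2013, §1.C Lemma 1.14] -/
theorem exists_krizLiCharacterBlock_3025a [Fact (Nat.Prime 11)] (W W₁ : WeierstrassCurve ℚ) [W.IsElliptic] [W₁.IsElliptic]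
    (hiso : IsIsogenous W W₁) (hW₁ : ∃ C : VariableChange ℚ, C • W₁ = cm11.quadraticTwist ((5 : ℤ) : ℚ))
    (K : Type) [Field K] [NumberField K] (hK2 : Module.finrank ℚ K = 2)
    (hdK : NumberField.discr K = -19) [NeZero (NumberField.discr K).natAbs] :
    ∃ (f : ℕ) (_ : NeZero f) (ψ : DirichletCharacter ℚ_[11] f) (ω : DirichletCharacter ℚ_[11] 11)
      (εK : DirichletCharacter ℚ_[11] (NumberField.discr K).natAbs),
      ψ.IsPrimitive ∧ IsTeichmullerCharacter ω ∧
      (∀ ℓ : ℕ, ℓ.Prime → ¬ (ℓ ∣ 11 * W.conductorNorm ℤ) →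
        ‖((W.LFunction ℓ : ℤ) : ℚ_[11]) - (ψ (ℓ : ZMod f) + ψ⁻¹ (ℓ : ZMod f) * ω (ℓ : ZMod 11))‖ < 1) ∧
      (ψ ((11 : ℕ) : ZMod f) ≠ 1 ∧ primVal (invMulOmega ψ ω) 11 ≠ 1) ∧
      (∀ ℓ : ℕ, (hℓ : ℓ.Prime) → ℓ ≠ 11 →
        (haveI := Fact.mk hℓ; ¬ W.HasGoodReductionAtPrime ℓ ∧ ¬ W.HasMultiplicativeReductionAtPrime ℓ) →
        ψ (ℓ : ZMod f) ≠ 1 ∧ primVal (invMulOmega ψ ω) ℓ ≠ 1) ∧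
      IsKroneckerCharacterOf K εK ∧
      ¬ (‖bernoulliOnePrim (bernoulliCharOne ψ εK) * bernoulliOnePrim (bernoulliCharTwo ψ εK ω)‖ ≤ ((11 : ℕ) : ℝ)⁻¹) ∧
      ψ.Odd := by
  haveI : Fact (Nat.Prime 19) := ⟨by norm_num⟩
  obtain ⟨ω, hω⟩ := exists_isTeichmullerCharacter (p := 11)
  obtain ⟨εK, hεK, hεKval⟩ := KrizLiBinders.exists_isKroneckerCharacterOf_of_discr (p := 11) hK2
    (Nat.Prime.prime (by norm_num : Nat.Prime 19)).squarefree (Or.inr ⟨hdK, by norm_num⟩)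
  have hd : (NumberField.discr K).natAbs = 19 := by rw [hdK]; rfl
  haveI : NeZero ((5 : ℤ)).natAbs := ⟨by decide⟩
  obtain ⟨χ, hχ⟩ := KrizLiBinders.exists_jacobiCharPadic (p := 11) ((5 : ℤ)).natAbs
  have hpar : χ (-1) * (-1) ^ 3 = -1 := by
    have e : ((4 : ℕ) : ZMod ((5 : ℤ)).natAbs) = -1 := by decide
    rw [← e, hχ 4]; norm_num
  obtain ⟨f, hf, ψ, hprim, hodd, hss, h1, h3, h4⟩ :=
    krizLi_characterBernoulliBlock_twist_odd (p := 11) (by norm_num) cm11 (k := 3) (by norm_num) (by norm_num)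
      (fun r _ hr => EisensteinTraceForm.hasGoodReductionAtPrime_cm11 r hr)
      (fun ℓ _ hℓ => by simpa using EisensteinTraceForm.lFunction_cm11_mod ℓ hℓ) W W₁ hiso (e := 5) (by norm_num)
      (by rw [← Int.squarefree_natAbs]; exact (Nat.Prime.prime (by norm_num)).squarefree) (by norm_num) hW₁ χ hχ hpar ω hω
      (q := 19) (by norm_num) (by norm_num) (by norm_num) hd εK hεKval
      (fun θ₁ hθ₁ => norm_generalizedBernoulli_theta1_3025a ω hω θ₁ hθ₁)
      (fun θ₂ hθ₂ => norm_generalizedBernoulli_theta2_3025a_19 ω hω θ₂ hθ₂)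
  exact ⟨f, hf, ψ, ω, εK, hprim, hω, hss, h1, h3, hεK, by exact_mod_cast h4, hodd⟩

end Summit.BirchSwinnertonDyer.BirchSwinnertonDyer.Theorems.PrintCFram.KrizLiBindersTwisted

end
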